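import Summits.ValiantsHypothesis.ValiantsHypothesis.Theorems.LacunarySymmetroidMatrixDescartesCensusDoorA34DefiniteTriple
import Summits.ValiantsHypothesis.ValiantsHypothesis.Theorems.LacunarySymmetroidMatrixDescartesCensusSpanRankDiagonal
import Summits.ValiantsHypothesis.ValiantsHypothesis.Theorems.LacunarySymmetroidMatrixDescartesCensusSignDefinite

/-!
# `MatrixDescartes` census — the DIAGONAL-ENDS GAUGE for `2 × 2` pencils: with one definite letter, two letters are WLOG diagonal

HONEST FRAMING.  Object-search cell `pub-symmetroid`, door-A item `Theses.LacunarySymmetroid.DoorA26 = PosRootLawAt 2 6 19`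
(stmt-ValiantsHypothesis-19979; OPEN, typed, never asserted).  A NORMAL-FORM reduction valid for every support and every number of letters `K`
(val-sym-door-p1 g11, structure memo DOOR-A26-P1G11-STRUCTURE.md §3b): congruence `S_l ↦ P S_l Pᵀ` (`det P ≠ 0`) keeps the number of distinct
positive determinant roots (`SpanRank.posRootCount_congr`, tree), and a DEFINITE letter `S_i` (`det S_i > 0`, real symmetric `2 × 2`) can be
diagonalised SIMULTANEOUSLY with any other letter `S_j` by one congruence (the tree's any-size `Census.exists_common_congruence` for a positive
definite matrix and a symmetric one, applied to `±S_i`).  Hence: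

* `posDef_of_det_pos_of_apply_pos` / `neg_posDef_of_det_pos_of_apply_neg` — a real symmetric `2 × 2` matrix with `det > 0` is positive definite or
  negative definite according to the sign of its `(0,0)` entry (from the tree's `mul_quadForm_pos_of_det_pos`);
* `exists_congr_diagonal_pair` — `det S > 0`, `S`, `T` symmetric ⇒ some `P` with `det P ≠ 0` makes `P S Pᵀ` and `P T Pᵀ` both DIAGONAL;
* **`posRootCount_le_of_diagonalPair`** — THE GAUGE (any `K`, any support `d`, any bound `B`, any two indices `i, j`): to bound the number of distinct
  positive det-roots of every symmetric `2 × 2` pencil whose letter `S_i` is definite, it suffices to bound it for the pencils whose letters `S_i` AND `S_j`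
  are diagonal — i.e. whose off-diagonal entry is a `(K−2)`-nomial on the OTHER exponents;
* `card_posRoots_le_nineteen_of_diagonalEnds` — door-A currency at `(2,6)`: on a support `d`, the row «`≤ 19` distinct positive roots» for all pencils with
  `det S_i > 0` follows from the same row for pencils with `S_i`, `S_j` diagonal.

READING FOR THE CENSUS LINE (`Cruxes/DoorA26/Lines/census.lean`): the four hard chambers `[1, 954, 1706, 1709]` are attacked in sign classes whose END
letters are definite (`DIIIID`, `DIIIDD` and mirrors); there a structural (coordinate) proof may assume `S₀` and `S₅` DIAGONAL, so that
`det F = α(x)β(x) − ζ(x)²` with `α, β` six-nomials (the diagonal entries) and the off-diagonal entry `ζ` a FOUR-nomial on the middle exponents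
`d₁, …, d₄` only — the eleven pair-sum coefficients touching an end letter are coefficients of the product `αβ` of two six-nomials.  The gauge
adds no invariant (Gram) information — the LP certificates are unaffected; it is a tool for coordinate arguments.  Nothing here bounds `ζ_sym(2,6)`;
`DoorA26` / `DoorA34` stay OPEN; nothing on the crux `MatrixDescartes` (stmt-ValiantsHypothesis-18050) or on `VP ≠ VNP`.

[folklore] Simultaneous diagonalisation of a symmetric pencil with a definite member by congruence; invariance of `det` roots under congruence.
-/

-- `Summit.ValiantsHypothesis.ValiantsHypothesis.…` repeats a component by the D-0017 layout
-- (single-conjunct summit), which the `dupNamespace` linter flags; the name is mandated.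
set_option linter.dupNamespace false

namespace Summit.ValiantsHypothesis.ValiantsHypothesis.Theorems.LacunarySymmetroidMatrixDescartes.Census

open Polynomial Finset Matrix
open scoped BigOperators Polynomial Matrix
open Summit.ValiantsHypothesis.ValiantsHypothesis.Theorems.LacunarySymmetroidMatrixDescartes.Census.SignSplit (pencil posRootCount)

/-! ### Definiteness of a `2 × 2` symmetric matrix with positive determinant -/

/-- A real symmetric `2 × 2` matrix with `det > 0` and `(0,0)` entry `> 0` is positive definite. [folklore] -/
theorem posDef_of_det_pos_of_apply_pos (S : Matrix (Fin 2) (Fin 2) ℝ) (hS : S.IsSymm) (hdet : 0 < S.det) (h00 : 0 < S 0 0) :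
    S.PosDef := by
  refine Matrix.PosDef.of_dotProduct_mulVec_pos ?_ ?_
  · unfold Matrix.IsHermitian; rw [conjTranspose_eq_transpose_of_trivial]; exact hS
  · intro x hx
    have h := mul_quadForm_pos_of_det_pos S hS hdet x hx
    rw [star_trivial]
    rcases lt_or_ge 0 (x ⬝ᵥ (S *ᵥ x)) with hq | hq
    · exact hq
    · exfalso; nlinarith [mul_nonneg h00.le (neg_nonneg.mpr hq)]

/-- A real symmetric `2 × 2` matrix with `det > 0` and `(0,0)` entry `< 0` is negative definite (`−S` positive definite). [folklore] -/
theorem neg_posDef_of_det_pos_of_apply_neg (S : Matrix (Fin 2) (Fin 2) ℝ) (hS : S.IsSymm) (hdet : 0 < S.det) (h00 : S 0 0 < 0) :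
    (-S).PosDef := by
  have hS' : (-S).IsSymm := by unfold Matrix.IsSymm at hS ⊢; rw [transpose_neg, hS]
  have hdet' : 0 < (-S).det := by
    rw [det_neg, Fintype.card_fin]; norm_num; exact hdet
  exact posDef_of_det_pos_of_apply_pos (-S) hS' hdet' (by rw [neg_apply]; linarith)

/-! ### Simultaneous diagonalisation by congruence -/

/-- Congruent letters stay symmetric: `(P S Pᵀ)ᵀ = P S Pᵀ` for symmetric `S`. [folklore] -/
theorem isSymm_conj_transpose {m : ℕ} (P S : Matrix (Fin m) (Fin m) ℝ) (hS : S.IsSymm) : (P * S * Pᵀ).IsSymm := by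
  unfold Matrix.IsSymm at hS ⊢
  rw [transpose_mul, transpose_mul, transpose_transpose, hS, Matrix.mul_assoc]

/-- **Simultaneous diagonalisation of a definite and a symmetric `2 × 2` letter by ONE congruence.**  If `S`, `T` are real symmetric `2 × 2`
and `det S > 0` (so `S` is definite), there is `P` with `det P ≠ 0` such that `P S Pᵀ` and `P T Pᵀ` are both diagonal. [folklore] -/
theorem exists_congr_diagonal_pair (S T : Matrix (Fin 2) (Fin 2) ℝ) (hS : S.IsSymm) (hT : T.IsSymm) (hdet : 0 < S.det) :
    ∃ P : Matrix (Fin 2) (Fin 2) ℝ, P.det ≠ 0 ∧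
      (P * S * Pᵀ) 0 1 = 0 ∧ (P * S * Pᵀ) 1 0 = 0 ∧ (P * T * Pᵀ) 0 1 = 0 ∧ (P * T * Pᵀ) 1 0 = 0 := by
  classical
  have h00 : S 0 0 ≠ 0 := by
    intro h0
    have hs : S 1 0 = S 0 1 := hS.apply 0 1
    rw [det_fin_two, h0, hs] at hdet
    nlinarith [sq_nonneg (S 0 1)]
  have hHT : T.IsHermitian := by unfold Matrix.IsHermitian; rw [conjTranspose_eq_transpose_of_trivial]; exact hT
  -- `A = ε S` positive definite for the right sign `ε`
  obtain ⟨ε, hε, hA⟩ : ∃ ε : ℝ, (ε = 1 ∨ ε = -1) ∧ (ε • S).PosDef := by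
    rcases lt_or_gt_of_ne h00 with hneg | hpos
    · exact ⟨-1, Or.inr rfl, by rw [neg_one_smul]; exact neg_posDef_of_det_pos_of_apply_neg S hS hdet hneg⟩
    · exact ⟨1, Or.inl rfl, by rw [one_smul]; exact posDef_of_det_pos_of_apply_pos S hS hdet hpos⟩
  obtain ⟨Y, β, hYdet, hAY, hTY⟩ := exists_common_congruence hA hHT
  have hYdu : IsUnit Y.det := isUnit_iff_ne_zero.mpr hYdet
  have hst : star Y = Yᵀ := by rw [star_eq_conjTranspose, conjTranspose_eq_transpose_of_trivial]
  have hcancel : star (Y⁻¹) * star Y = 1 := by rw [← star_mul, mul_nonsing_inv Y hYdu, star_one]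
  have hcancel' : Y * Y⁻¹ = 1 := mul_nonsing_inv Y hYdu
  refine ⟨star (Y⁻¹), ?_, ?_, ?_, ?_, ?_⟩
  · exact det_ne_zero_of_right_inverse hcancel
  all_goals
    have hPt : (star (Y⁻¹))ᵀ = Y⁻¹ := by
      rw [star_eq_conjTranspose, conjTranspose_eq_transpose_of_trivial, transpose_transpose]
  · -- `P S Pᵀ = ε⁻¹ • 1`, hence diagonal
    have hSε : S = ε • (ε • S) := by
      rcases hε with h | h <;> subst h <;> simp
    have key : star Y⁻¹ * S * (star Y⁻¹)ᵀ = ε • (1 : Matrix (Fin 2) (Fin 2) ℝ) := by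
      rw [hPt, hSε, hAY]
      calc star Y⁻¹ * (ε • (star Y * Y)) * Y⁻¹ = ε • ((star Y⁻¹ * star Y) * (Y * Y⁻¹)) := by
            simp only [Matrix.mul_smul, Matrix.smul_mul, Matrix.mul_assoc]
        _ = ε • 1 := by rw [hcancel, hcancel', one_mul]
    rw [key]; simp
  · have hSε : S = ε • (ε • S) := by
      rcases hε with h | h <;> subst h <;> simp
    have key : star Y⁻¹ * S * (star Y⁻¹)ᵀ = ε • (1 : Matrix (Fin 2) (Fin 2) ℝ) := by
      rw [hPt, hSε, hAY]
      calc star Y⁻¹ * (ε • (star Y * Y)) * Y⁻¹ = ε • ((star Y⁻¹ * star Y) * (Y * Y⁻¹)) := by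
            simp only [Matrix.mul_smul, Matrix.smul_mul, Matrix.mul_assoc]
        _ = ε • 1 := by rw [hcancel, hcancel', one_mul]
    rw [key]; simp
  · have key : star Y⁻¹ * T * (star Y⁻¹)ᵀ = diagonal β := by
      rw [hPt, hTY]
      calc star Y⁻¹ * (star Y * diagonal β * Y) * Y⁻¹ = (star Y⁻¹ * star Y) * diagonal β * (Y * Y⁻¹) := by
            simp only [Matrix.mul_assoc]
        _ = diagonal β := by rw [hcancel, hcancel', one_mul, mul_one]
    rw [key]; simp
  · have key : star Y⁻¹ * T * (star Y⁻¹)ᵀ = diagonal β := by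
      rw [hPt, hTY]
      calc star Y⁻¹ * (star Y * diagonal β * Y) * Y⁻¹ = (star Y⁻¹ * star Y) * diagonal β * (Y * Y⁻¹) := by
            simp only [Matrix.mul_assoc]
        _ = diagonal β := by rw [hcancel, hcancel', one_mul, mul_one]
    rw [key]; simp

/-! ### The gauge: bounding the census count with two diagonal letters suffices -/

/-- **DIAGONAL-ENDS GAUGE** (symmetric `2 × 2` letters, ANY number of letters `K`, ANY support `d`, ANY bound `B`).  Fix indices `i, j`.  If the
census count `posRootCount d S` (distinct positive roots of `det ∑ X^(d l) • S l`) is at most `B` for every symmetric pencil whose letters `S i` and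
`S j` are DIAGONAL, then it is at most `B` for every symmetric pencil whose letter `S i` is definite (`det (S i) > 0`): congruence by the
simultaneous diagonaliser of `(S i, S j)` keeps the count (`SpanRank.posRootCount_congr`). [folklore] -/
theorem posRootCount_le_of_diagonalPair {K : ℕ} (d : Fin K → ℕ) (B : ℕ) (i j : Fin K)
    (h : ∀ S : Fin K → Matrix (Fin 2) (Fin 2) ℝ, (∀ l, (S l).IsSymm) →
      (S i) 0 1 = 0 → (S i) 1 0 = 0 → (S j) 0 1 = 0 → (S j) 1 0 = 0 → posRootCount d S ≤ B)
    (S : Fin K → Matrix (Fin 2) (Fin 2) ℝ) (hS : ∀ l, (S l).IsSymm) (hi : 0 < (S i).det) :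
    posRootCount d S ≤ B := by
  obtain ⟨P, hP, h1, h2, h3, h4⟩ := exists_congr_diagonal_pair (S i) (S j) (hS i) (hS j) hi
  have hb := h (fun l => P * S l * Pᵀ) (fun l => isSymm_conj_transpose P (S l) (hS l)) h1 h2 h3 h4
  rwa [SpanRank.posRootCount_congr d S P hP] at hb

/-- **Door-A currency at `(2,6)`** (ANY support `d`, any two indices `i, j`): if every symmetric six-term `2 × 2` pencil on `d` with `S i`, `S j`
DIAGONAL has at most `19` distinct positive det-roots, then so does every symmetric pencil on `d` whose letter `S i` is definite.  (On the
hard chambers of the census line both END letters are definite in the attacked sign classes, so `i, j = 0, 5`: the off-diagonal entry of the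
pencil is then a four-nomial on the middle exponents.) [folklore] -/
theorem card_posRoots_le_nineteen_of_diagonalEnds (d : Fin 6 → ℕ) (i j : Fin 6)
    (h : ∀ S : Fin 6 → Matrix (Fin 2) (Fin 2) ℝ, (∀ l, (S l).IsSymm) →
      (S i) 0 1 = 0 → (S i) 1 0 = 0 → (S j) 0 1 = 0 → (S j) 1 0 = 0 →
        ((Matrix.det (∑ l, ((X : ℝ[X]) ^ d l) • (S l).map C)).roots.toFinset.filter (fun t => 0 < t)).card ≤ 19)
    (S : Fin 6 → Matrix (Fin 2) (Fin 2) ℝ) (hS : ∀ l, (S l).IsSymm) (hi : 0 < (S i).det) :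
    ((Matrix.det (∑ l, ((X : ℝ[X]) ^ d l) • (S l).map C)).roots.toFinset.filter (fun t => 0 < t)).card ≤ 19 := by
  change posRootCount d S ≤ 19
  exact posRootCount_le_of_diagonalPair d 19 i j (fun S' hS' h1 h2 h3 h4 => h S' hS' h1 h2 h3 h4) S hS hi

end Summit.ValiantsHypothesis.ValiantsHypothesis.Theorems.LacunarySymmetroidMatrixDescartes.Census
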